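import Literature.Barriers.MatrixMultiplication.UnstableTensorBarrierVertex
import Mathlib.Topology.Algebra.Module.FiniteDimension
import Mathlib.Topology.Instances.Matrix
import HarnessLib

/-!
# Explicit separating weights: margin `1`, entries at most `2n·√3^{3n}` (towards BL Thm. 17)

Topic `Literature/Barriers/MatrixMultiplication`; part of the PROOF of the catalogue entry
`UnstableTensorBarrier` (Bläser–Lysikov 2020, Thm. 16 ∧ Thm. 17). Everything here is PROVED.

Bläser–Lysikov derive the explicit irreversibility bound of Thm. 17 from the weight-margin lower
bound `γ ≥ √3^{-3n}(3n)^{-1}` of Bürgisser et al. ([11], Thms. 6.4/6.8; arXiv Thm. 6.10: Cramer's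
rule on an integral vertex system plus Hadamard's inequality). We prove the corresponding
statement for separating weights directly, in the form consumed by the slice-rank bound
(`UnstableTensorBarrierSliceRankBound.lean`): if a support `S ⊆ ι × κ × μ` (`|ι| = |κ| = |μ| = n`)
admits real weights `x, y, z` of total sum `0` each with `x a + y b + z c ≥ 1` on `S`, then it
admits such weights with all entries bounded by `2n·√3^{3n}` in absolute value.

Proof. Minimise `∑ⱼ wⱼ` over the polytope `P = {w ∈ [-1,1]^{ι⊔κ⊔μ} | w_a + w_b + w_c ≥ 0 on S}`;
`(x - ⅓, y - ⅓, z - ⅓)` scaled into the box shows the minimum `m` is negative; at an extreme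
minimiser `w` (`exists_mem_extremePoints_forall_le`) the tight constraints span (vertex lemma), a
basis among them gives an integral `{0, ±1}` system `M w = r` with `det M · wⱼ ∈ ℤ` (Cramer), so
`|det M| · |m| ≥ 1`, while `det(M)² ≤ ∏ (row norms)² ≤ 3^{3n}` (Hadamard). The weights
`(w_block - mean)/σ`, `σ = -m/n ≥ n^{-1}√3^{-3n}`, have margin `≥ 1` and entries `≤ 2/σ`.

## Content

* `one_le_sqrt_three_pow_mul_abs_sum` — the Diophantine core for a general constraint family with
  integral data and squared row norms `≤ 3`: at an extreme point `w` with `∑ w < 0`,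
  `1 ≤ √3^{|J|} · |∑ w|`.
* `exists_bounded_sepWeight` — the statement above.

## References

* M. Bläser, V. Lysikov, MFCS 2020, LIPIcs 170, 17, proof of Thm. 17. [BlaserLysikov2020]
* P. Bürgisser, C. Franks, A. Garg, R. Oliveira, M. Walter, A. Wigderson, FOCS 2019 =
  arXiv:1910.12375, §6, Thm. 6.10 (general weight margin lower bound). Cited through BL.
-/

noncomputable section

open scoped BigOperators Matrix
open _root_.Filter _root_.Topology

namespace Literature.Barriers.MatrixMultiplication

universe u

/-! ## The Diophantine core: `|∑ w| ≥ √3^{-|J|}` at an integral vertex -/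

section Core

variable {J : Type*} [Fintype J] [DecidableEq J] {Kc : Type*} [Fintype Kc]

/-- At an extreme point `w` of a polyhedron `{v | ∀ k, b k ≤ a k ⬝ᵥ v}` whose constraint data are
integral (`a k ∈ ℤ^J`, `b k ∈ ℤ`) with squared row norms `∑ⱼ (a k j)² ≤ 3`, a negative value of
`∑ⱼ wⱼ` is at most `-√3^{-|J|}`: the tight rows contain a basis (vertex lemma), Cramer's rule makes
`det(M)·wⱼ` integral for the corresponding `{a k}`-matrix `M`, and Hadamard bounds `|det M|`.
This is the weight-margin bound of Bürgisser et al. in the form used here.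
[cite: BlaserLysikov2020, Thm. 17 (proof)] -/
theorem one_le_sqrt_three_pow_mul_abs_sum (a : Kc → J → ℝ) (b : Kc → ℝ)
    (hint : ∀ k, ∃ r : J → ℤ, a k = fun j => (r j : ℝ)) (hbint : ∀ k, ∃ q : ℤ, b k = q)
    (hrow : ∀ k, ∑ j, a k j ^ 2 ≤ 3) {w : J → ℝ}
    (hw : w ∈ Set.extremePoints ℝ {v : J → ℝ | ∀ k, b k ≤ a k ⬝ᵥ v}) (hneg : ∑ j, w j < 0) :
    1 ≤ Real.sqrt 3 ^ Fintype.card J * |∑ j, w j| := by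
  classical
  have hspan := span_tight_eq_top_of_mem_extremePoints a b hw
  obtain ⟨B, hBsub, hBspan, hli⟩ := exists_linearIndependent ℝ (a '' {k | a k ⬝ᵥ w = b k})
  rw [hspan] at hBspan
  have hBfin : B.Finite :=
    (Set.finite_range a).subset (hBsub.trans (Set.image_subset_range _ _))
  haveI : Fintype B := hBfin.fintype
  -- `|B| = |J|`
  have hcard : Fintype.card B = Fintype.card J := by
    have h1 := finrank_span_eq_card hli
    rw [Subtype.range_coe, hBspan, finrank_top, Module.finrank_fintype_fun_eq_card] at h1
    exact h1.symm
  obtain ⟨e⟩ : Nonempty (J ≃ B) := ⟨(Fintype.equivOfCardEq hcard).symm⟩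
  have hmemB : ∀ i, ((e i : B) : J → ℝ) ∈ a '' {k | a k ⬝ᵥ w = b k} := fun i => hBsub (e i).2
  choose kf hkT hka using hmemB
  choose r hr using hint
  choose q hq using hbint
  -- the integral square system `M w = rhs`
  set Mz : Matrix J J ℤ := fun i j => r (kf i) j with hMz
  set M : Matrix J J ℝ := Mz.map (Int.cast : ℤ → ℝ) with hM
  have hMrow : ∀ i, M i = a (kf i) := fun i => by
    funext j
    rw [hr (kf i)]
    rfl
  have hli' : LinearIndependent ℝ M.row := by
    have : M.row = (Subtype.val ∘ e) := funext fun i => by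
      rw [Matrix.row, hMrow, hka]
      rfl
    rw [this]
    exact hli.comp e e.injective
  have hdet : M.det ≠ 0 :=
    ((Matrix.isUnit_iff_isUnit_det M).1 (Matrix.linearIndependent_rows_iff_isUnit.1 hli')).ne_zero
  have hsys : M *ᵥ w = fun i => ((q (kf i) : ℤ) : ℝ) := by
    funext i
    change M i ⬝ᵥ w = _
    rw [hMrow, ← hq]
    exact hkT i
  -- Cramer: `det M · w j ∈ ℤ`, hence `det M · ∑ w ∈ ℤ ∖ {0}`
  have hint' : ∀ j, ∃ N : ℤ, M.det * w j = N := fun j =>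
    exists_int_det_mul_eq Mz (fun i => q (kf i)) w hsys j
  choose N hN using hint'
  have hsumN : M.det * ∑ j, w j = ((∑ j, N j : ℤ) : ℝ) := by
    rw [Finset.mul_sum, Int.cast_sum]
    exact Finset.sum_congr rfl fun j _ => hN j
  have hNne : (∑ j, N j) ≠ 0 := by
    intro h0
    rw [h0, Int.cast_zero] at hsumN
    exact (mul_ne_zero hdet hneg.ne) hsumN
  have hone : (1 : ℝ) ≤ |M.det| * |∑ j, w j| := by
    rw [← abs_mul, hsumN, ← Int.cast_abs]
    exact_mod_cast Int.one_le_abs hNne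
  -- Hadamard: `|det M| ≤ √3^{|J|}`
  have hH : M.det ^ 2 ≤ (3 : ℝ) ^ Fintype.card J := by
    refine (det_sq_le_prod_sum_sq M).trans ?_
    calc ∏ i, ∑ j, M i j ^ 2 ≤ ∏ _i : J, (3 : ℝ) :=
          Finset.prod_le_prod (fun i _ => Finset.sum_nonneg fun j _ => sq_nonneg _) fun i _ => by
            have : ∑ j, M i j ^ 2 = ∑ j, a (kf i) j ^ 2 :=
              Finset.sum_congr rfl fun j _ => by rw [← hMrow i]
            rw [this]
            exact hrow (kf i)
      _ = 3 ^ Fintype.card J := by rw [Finset.prod_const, Finset.card_univ]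
  have habs : |M.det| ≤ Real.sqrt 3 ^ Fintype.card J := by
    refine abs_le_of_sq_le_sq ?_ (by positivity)
    calc M.det ^ 2 ≤ (3 : ℝ) ^ Fintype.card J := hH
      _ = (Real.sqrt 3 ^ Fintype.card J) ^ 2 := by
          rw [← pow_mul, mul_comm, pow_mul, Real.sq_sqrt (by norm_num)]
  calc (1 : ℝ) ≤ |M.det| * |∑ j, w j| := hone
    _ ≤ Real.sqrt 3 ^ Fintype.card J * |∑ j, w j| :=
        mul_le_mul_of_nonneg_right habs (abs_nonneg _)

end Core

/-! ## The polytope of the tensor problem and the bounded separating weight -/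

section Tensor

variable {ι κ μ : Type} [Fintype ι] [Fintype κ] [Fintype μ] [DecidableEq ι] [DecidableEq κ]
  [DecidableEq μ]

/-- Dot product with the `{0,1}`-row of a triple `q = (a, b, c)`: `w_a + w_b + w_c`. [folklore] -/
theorem rowTriple_dotProduct (q : ι × κ × μ) (v : ι ⊕ κ ⊕ μ → ℝ) :
    (fun j => ((Sum.elim (fun a' => if a' = q.1 then (1 : ℤ) else 0)
        (Sum.elim (fun b' => if b' = q.2.1 then (1 : ℤ) else 0)
          (fun c' => if c' = q.2.2 then (1 : ℤ) else 0)) j : ℤ) : ℝ)) ⬝ᵥ v =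
      v (Sum.inl q.1) + v (Sum.inr (Sum.inl q.2.1)) + v (Sum.inr (Sum.inr q.2.2)) := by
  simp only [dotProduct, Fintype.sum_sum_type, Sum.elim_inl, Sum.elim_inr, Int.cast_ite,
    Int.cast_one, Int.cast_zero, ite_mul, one_mul, zero_mul, Finset.sum_ite_eq', Finset.mem_univ,
    if_true]
  ring

/-- The `{0,1}`-row of a triple has squared norm `3`. [folklore] -/
theorem rowTriple_sum_sq (q : ι × κ × μ) :
    ∑ j, ((Sum.elim (fun a' => if a' = q.1 then (1 : ℤ) else 0)
        (Sum.elim (fun b' => if b' = q.2.1 then (1 : ℤ) else 0)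
          (fun c' => if c' = q.2.2 then (1 : ℤ) else 0)) j : ℤ) : ℝ) ^ 2 = 3 := by
  simp only [Fintype.sum_sum_type, Sum.elim_inl, Sum.elim_inr, Int.cast_ite, Int.cast_one,
    Int.cast_zero, ite_pow, one_pow, zero_pow (two_ne_zero), Finset.sum_ite_eq', Finset.mem_univ,
    if_true]
  norm_num

/-- Dot product with the cast of `± Pi.single j 1`. [folklore] -/
theorem single_cast_dotProduct {J : Type*} [Fintype J] [DecidableEq J] (j : J) (σ : ℤ)
    (v : J → ℝ) : (fun l => ((σ • (Pi.single j (1 : ℤ) : J → ℤ)) l : ℝ)) ⬝ᵥ v = σ * v j := by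
  simp only [dotProduct, Pi.smul_apply, smul_eq_mul, Pi.single_apply, mul_ite, mul_one, mul_zero,
    Int.cast_ite, Int.cast_zero, ite_mul, zero_mul, Finset.sum_ite_eq', Finset.mem_univ, if_true]

/-- The cast of `± Pi.single j 1` has squared norm `σ²`. [folklore] -/
theorem single_cast_sum_sq {J : Type*} [Fintype J] [DecidableEq J] (j : J) (σ : ℤ) :
    ∑ l, ((σ • (Pi.single j (1 : ℤ) : J → ℤ)) l : ℝ) ^ 2 = (σ : ℝ) ^ 2 := by
  simp only [Pi.smul_apply, smul_eq_mul, Pi.single_apply, mul_ite, mul_one, mul_zero, Int.cast_ite,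
    Int.cast_zero, ite_pow, zero_pow (two_ne_zero), Finset.sum_ite_eq', Finset.mem_univ, if_true]

/-- **Explicit separating weights** (the weight-margin bound of Bürgisser et al. in the form used
for BL Thm. 17): if `S ⊆ ι × κ × μ` (`|ι| = |κ| = |μ| = n ≥ 1`) admits real weights of total sum
`0` on each index set with `x a + y b + z c ≥ 1` on `S`, then it admits such weights with all
entries of absolute value `≤ 2n·√3^{3n}`. [cite: BlaserLysikov2020, Thm. 17 (proof)] -/
theorem exists_bounded_sepWeight {n : ℕ} (hn : 0 < n) (hι : Fintype.card ι = n)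
    (hκ : Fintype.card κ = n) (hμ : Fintype.card μ = n) (S : Finset (ι × κ × μ))
    (x : ι → ℝ) (y : κ → ℝ) (z : μ → ℝ) (hx : ∑ a, x a = 0) (hy : ∑ b, y b = 0)
    (hz : ∑ c, z c = 0) (hsep : ∀ p ∈ S, 1 ≤ x p.1 + y p.2.1 + z p.2.2) :
    ∃ (x' : ι → ℝ) (y' : κ → ℝ) (z' : μ → ℝ), ∑ a, x' a = 0 ∧ ∑ b, y' b = 0 ∧ ∑ c, z' c = 0 ∧
      (∀ p ∈ S, 1 ≤ x' p.1 + y' p.2.1 + z' p.2.2) ∧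
      (∀ a, |x' a| ≤ 2 * n * Real.sqrt 3 ^ (3 * n)) ∧
      (∀ b, |y' b| ≤ 2 * n * Real.sqrt 3 ^ (3 * n)) ∧
      (∀ c, |z' c| ≤ 2 * n * Real.sqrt 3 ^ (3 * n)) := by
  classical
  -- the constraint family on `J = ι ⊕ κ ⊕ μ`, indexed by `↥S ⊕ (J ⊕ J)`
  obtain ⟨az, haz⟩ : ∃ az : (↥S ⊕ ((ι ⊕ κ ⊕ μ) ⊕ (ι ⊕ κ ⊕ μ))) → (ι ⊕ κ ⊕ μ) → ℤ,
      az = Sum.elim (fun p : ↥S => Sum.elim (fun a' => if a' = p.1.1 then (1 : ℤ) else 0)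
        (Sum.elim (fun b' => if b' = p.1.2.1 then (1 : ℤ) else 0)
          (fun c' => if c' = p.1.2.2 then (1 : ℤ) else 0)))
        (Sum.elim (fun j => (1 : ℤ) • (Pi.single j (1 : ℤ) : (ι ⊕ κ ⊕ μ) → ℤ))
          (fun j => (-1 : ℤ) • (Pi.single j (1 : ℤ) : (ι ⊕ κ ⊕ μ) → ℤ))) := ⟨_, rfl⟩
  obtain ⟨bz, hbz⟩ : ∃ bz : (↥S ⊕ ((ι ⊕ κ ⊕ μ) ⊕ (ι ⊕ κ ⊕ μ))) → ℤ,
      bz = Sum.elim (fun _ => 0) (fun _ => -1) := ⟨_, rfl⟩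
  set a : (↥S ⊕ ((ι ⊕ κ ⊕ μ) ⊕ (ι ⊕ κ ⊕ μ))) → (ι ⊕ κ ⊕ μ) → ℝ := fun k j => (az k j : ℝ)
    with ha
  set b : (↥S ⊕ ((ι ⊕ κ ⊕ μ) ⊕ (ι ⊕ κ ⊕ μ))) → ℝ := fun k => (bz k : ℝ) with hb
  set P : Set (ι ⊕ κ ⊕ μ → ℝ) := {v | ∀ k, b k ≤ a k ⬝ᵥ v} with hP
  -- membership in `P`
  have hmemP : ∀ v : ι ⊕ κ ⊕ μ → ℝ, v ∈ P ↔
      (∀ p ∈ S, 0 ≤ v (Sum.inl p.1) + v (Sum.inr (Sum.inl p.2.1)) + v (Sum.inr (Sum.inr p.2.2))) ∧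
        ∀ j, |v j| ≤ 1 := by
    intro v
    have hrow : ∀ p : ↥S, a (Sum.inl p) ⬝ᵥ v =
        v (Sum.inl p.1.1) + v (Sum.inr (Sum.inl p.1.2.1)) + v (Sum.inr (Sum.inr p.1.2.2)) :=
      fun p => by
        rw [ha, haz]
        exact rowTriple_dotProduct p.1 v
    have hlow : ∀ j, a (Sum.inr (Sum.inl j)) ⬝ᵥ v = v j := fun j => by
      rw [ha, haz]
      simpa using single_cast_dotProduct j 1 v
    have hupp : ∀ j, a (Sum.inr (Sum.inr j)) ⬝ᵥ v = -v j := fun j => by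
      rw [ha, haz]
      simpa using single_cast_dotProduct j (-1) v
    have hbS : ∀ p : ↥S, b (Sum.inl p) = 0 := fun p => by simp [hb, hbz]
    have hbl : ∀ j, b (Sum.inr (Sum.inl j)) = -1 := fun j => by simp [hb, hbz]
    have hbu : ∀ j, b (Sum.inr (Sum.inr j)) = -1 := fun j => by simp [hb, hbz]
    constructor
    · intro h
      refine ⟨fun p hp => ?_, fun j => abs_le.2 ⟨?_, ?_⟩⟩
      · have := h (Sum.inl ⟨p, hp⟩)
        rwa [hrow, hbS] at this
      · have := h (Sum.inr (Sum.inl j))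
        rwa [hlow, hbl] at this
      · have := h (Sum.inr (Sum.inr j))
        rw [hupp, hbu] at this
        linarith
    · rintro ⟨h1, h2⟩ k
      rcases k with p | j | j
      · rw [hrow, hbS]
        exact h1 p.1 p.2
      · rw [hlow, hbl]
        exact (abs_le.1 (h2 j)).1
      · rw [hupp, hbu]
        linarith [(abs_le.1 (h2 j)).2]
  -- `P` is compact and contains `0`
  have hPc : IsCompact P := by
    have hbox : IsCompact (Set.univ.pi fun _ : ι ⊕ κ ⊕ μ => Set.Icc (-1 : ℝ) 1) :=
      isCompact_univ_pi fun _ => isCompact_Icc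
    refine hbox.of_isClosed_subset ?_ fun v hv => ?_
    · rw [hP, Set.setOf_forall]
      exact isClosed_iInter fun k =>
        isClosed_le continuous_const (continuous_const.dotProduct continuous_id)
    · rw [hmemP] at hv
      exact Set.mem_univ_pi.2 fun j => abs_le.1 (hv.2 j)
  have hP0 : (0 : ι ⊕ κ ⊕ μ → ℝ) ∈ P := by
    rw [hmemP]
    exact ⟨fun p _ => by simp, fun j => by simp⟩
  -- a feasible point with negative coordinate sum
  set w₀ : ι ⊕ κ ⊕ μ → ℝ := Sum.elim (fun a' => x a' - 1 / 3)
    (Sum.elim (fun b' => y b' - 1 / 3) (fun c' => z c' - 1 / 3)) with hw₀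
  set R : ℝ := 1 + ∑ j, |w₀ j| with hR
  have hRpos : 0 < R := by
    have : 0 ≤ ∑ j, |w₀ j| := Finset.sum_nonneg fun j _ => abs_nonneg _
    linarith
  have hw₀R : ∀ j, |w₀ j| ≤ R := fun j => by
    have := Finset.single_le_sum (f := fun j => |w₀ j|) (fun j _ => abs_nonneg _) (Finset.mem_univ j)
    linarith
  have hw₁P : R⁻¹ • w₀ ∈ P := by
    rw [hmemP]
    refine ⟨fun p hp => ?_, fun j => ?_⟩
    · simp only [Pi.smul_apply, smul_eq_mul, hw₀, Sum.elim_inl, Sum.elim_inr]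
      have h := hsep p hp
      have : 0 ≤ x p.1 - 1 / 3 + (y p.2.1 - 1 / 3) + (z p.2.2 - 1 / 3) := by linarith
      have := mul_nonneg (inv_nonneg.2 hRpos.le) this
      linarith
    · rw [Pi.smul_apply, smul_eq_mul, abs_mul, abs_inv, abs_of_pos hRpos]
      rw [inv_mul_le_iff₀ hRpos, mul_one]
      exact hw₀R j
  have hsum₀ : ∑ j, w₀ j = -n := by
    simp only [hw₀, Fintype.sum_sum_type, Sum.elim_inl, Sum.elim_inr, Finset.sum_sub_distrib, hx,
      hy, hz, Finset.sum_const, Finset.card_univ, hι, hκ, hμ, nsmul_eq_mul]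
    ring
  have hsum₁ : ∑ j, (R⁻¹ • w₀) j < 0 := by
    simp only [Pi.smul_apply, smul_eq_mul, ← Finset.mul_sum, hsum₀]
    have : (0 : ℝ) < n := by exact_mod_cast hn
    have := mul_pos (inv_pos.2 hRpos) this
    linarith
  -- an extreme point minimising the coordinate sum
  set lsum : (ι ⊕ κ ⊕ μ → ℝ) →ₗ[ℝ] ℝ :=
    { toFun := fun v => ∑ j, v j
      map_add' := fun v v' => by simp [Finset.sum_add_distrib]
      map_smul' := fun c v => by
        simp only [Pi.smul_apply, smul_eq_mul, RingHom.id_apply, Finset.mul_sum] } with hlsum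
  obtain ⟨w, hwext, hwmin⟩ :=
    exists_mem_extremePoints_forall_le hPc ⟨0, hP0⟩ (LinearMap.toContinuousLinearMap lsum)
  have hwmin' : ∀ v ∈ P, ∑ j, w j ≤ ∑ j, v j := fun v hv => hwmin v hv
  have hwP : w ∈ P := hwext.1
  have hneg : ∑ j, w j < 0 := (hwmin' _ hw₁P).trans_lt hsum₁
  -- the Diophantine core
  have hcore : 1 ≤ Real.sqrt 3 ^ Fintype.card (ι ⊕ κ ⊕ μ) * |∑ j, w j| := by
    refine one_le_sqrt_three_pow_mul_abs_sum a b (fun k => ⟨az k, rfl⟩) (fun k => ⟨bz k, rfl⟩)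
      (fun k => ?_) hwext hneg
    rcases k with p | j | j
    · rw [ha, haz]
      exact (rowTriple_sum_sq p.1).le
    · rw [ha, haz]
      have := single_cast_sum_sq j 1
      simp only [Sum.elim_inl, Sum.elim_inr, Int.cast_one, one_pow] at this ⊢
      rw [this]
      norm_num
    · rw [ha, haz]
      have := single_cast_sum_sq j (-1)
      simp only [Sum.elim_inr, Int.cast_neg, Int.cast_one] at this ⊢
      rw [this]
      norm_num
  have hcardJ : Fintype.card (ι ⊕ κ ⊕ μ) = 3 * n := by
    rw [Fintype.card_sum, Fintype.card_sum, hι, hκ, hμ]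
    ring
  rw [hcardJ] at hcore
  -- the normalised weights
  rw [hmemP] at hwP
  obtain ⟨hwS, hwbox⟩ := hwP
  set m : ℝ := ∑ j, w j with hm
  set σ : ℝ := -m / n with hσ
  have hnR : (0 : ℝ) < n := by exact_mod_cast hn
  have hσpos : 0 < σ := by
    rw [hσ]
    exact div_pos (by linarith) hnR
  set xb : ℝ := (∑ a', w (Sum.inl a')) / n with hxb
  set yb : ℝ := (∑ b', w (Sum.inr (Sum.inl b'))) / n with hyb
  set zb : ℝ := (∑ c', w (Sum.inr (Sum.inr c'))) / n with hzb
  have hmsplit : m = ∑ a', w (Sum.inl a') + ∑ b', w (Sum.inr (Sum.inl b')) +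
      ∑ c', w (Sum.inr (Sum.inr c')) := by
    rw [hm, Fintype.sum_sum_type, Fintype.sum_sum_type, add_assoc]
  have hmeans : xb + yb + zb = -σ := by
    rw [hxb, hyb, hzb, hσ, hmsplit]
    field_simp
  -- bounds `|mean| ≤ 1`
  have hmean_le : ∀ {X : Type} [Fintype X] (f : X → ℝ), (∀ i, |f i| ≤ 1) →
      Fintype.card X = n → |(∑ i, f i) / n| ≤ 1 := by
    intro X _ f hf hX
    rw [abs_div, Nat.abs_cast, div_le_one hnR]
    calc |∑ i, f i| ≤ ∑ i, |f i| := Finset.abs_sum_le_sum_abs _ _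
      _ ≤ ∑ _i : X, (1 : ℝ) := Finset.sum_le_sum fun i _ => hf i
      _ = n := by rw [Finset.sum_const, Finset.card_univ, hX, nsmul_eq_mul, mul_one]
  have hxb1 : |xb| ≤ 1 := hmean_le (fun a' => w (Sum.inl a')) (fun a' => hwbox _) hι
  have hyb1 : |yb| ≤ 1 := hmean_le (fun b' => w (Sum.inr (Sum.inl b'))) (fun b' => hwbox _) hκ
  have hzb1 : |zb| ≤ 1 := hmean_le (fun c' => w (Sum.inr (Sum.inr c'))) (fun c' => hwbox _) hμ
  -- `2/σ ≤ 2n √3^{3n}`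
  have hbound : 2 / σ ≤ 2 * n * Real.sqrt 3 ^ (3 * n) := by
    have habsm : |m| = n * σ := by
      rw [hσ, abs_of_neg hneg]
      field_simp
    rw [habsm] at hcore
    rw [div_le_iff₀ hσpos]
    nlinarith [hcore, hσpos, hnR]
  have hentry : ∀ (t c : ℝ), |t| ≤ 1 → |c| ≤ 1 → |(t - c) / σ| ≤ 2 * n * Real.sqrt 3 ^ (3 * n) := by
    intro t c ht hc
    rw [abs_div, abs_of_pos hσpos]
    refine le_trans ?_ hbound
    rw [div_le_div_iff_of_pos_right hσpos]
    calc |t - c| ≤ |t| + |c| := abs_sub _ _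
      _ ≤ 2 := by linarith
  refine ⟨fun a' => (w (Sum.inl a') - xb) / σ, fun b' => (w (Sum.inr (Sum.inl b')) - yb) / σ,
    fun c' => (w (Sum.inr (Sum.inr c')) - zb) / σ, ?_, ?_, ?_, fun p hp => ?_,
    fun a' => hentry _ _ (hwbox _) hxb1, fun b' => hentry _ _ (hwbox _) hyb1,
    fun c' => hentry _ _ (hwbox _) hzb1⟩
  · rw [← Finset.sum_div, Finset.sum_sub_distrib, Finset.sum_const, Finset.card_univ, hι, hxb,
      nsmul_eq_mul, mul_div_cancel₀ _ hnR.ne', sub_self, zero_div]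
  · rw [← Finset.sum_div, Finset.sum_sub_distrib, Finset.sum_const, Finset.card_univ, hκ, hyb,
      nsmul_eq_mul, mul_div_cancel₀ _ hnR.ne', sub_self, zero_div]
  · rw [← Finset.sum_div, Finset.sum_sub_distrib, Finset.sum_const, Finset.card_univ, hμ, hzb,
      nsmul_eq_mul, mul_div_cancel₀ _ hnR.ne', sub_self, zero_div]
  · have hS := hwS p hp
    have key : (w (Sum.inl p.1) - xb) / σ + (w (Sum.inr (Sum.inl p.2.1)) - yb) / σ +
        (w (Sum.inr (Sum.inr p.2.2)) - zb) / σ =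
        (w (Sum.inl p.1) + w (Sum.inr (Sum.inl p.2.1)) + w (Sum.inr (Sum.inr p.2.2))) / σ + 1 := by
      have hσne : σ ≠ 0 := hσpos.ne'
      have : xb + yb + zb = -σ := hmeans
      field_simp
      linarith
    rw [key]
    have := div_nonneg hS hσpos.le
    linarith

end Tensor

end Literature.Barriers.MatrixMultiplication

end
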